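/-
Copyright (c) 2026 the pub-hodgecm-mathlib formalisation cell (harness21).  Prover seat hodgecm-mathlib-F0P3a-p07 (g19): ROAD «HC-D» (holder F0P2-p01 (g23)),
brick (MP) «MODEL PINS FOR (MI)», 2026-09-02.
-/
import Literature.NumberTheory.Automorphic.UnitaryGroupInertPlaceHyperbolicBasis   -- ★ `galAdicCompletionMap_galAdicCompletionMap_of_smul_eq`; brings ★ `UnitaryGroupNonsplitPlace` (`PlacesOver.subsingleton_of_smul_eq`, `LocalRing.eq_iff_apply_eq`), ★ `UnitaryGroupSplitPlace` (`algEquiv_mul_self_eq_one`)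
import Literature.NumberTheory.Automorphic.AnisotropicUnitaryGroupCompactOfPlace    -- ★ `conjLocal_apply_eq_of_smul_eq`
import Literature.NumberTheory.Automorphic.QuadraticLocalBaseChange                  -- ★ `toPlace`, `toLocalRing`, `existsUnique_eq_add_mul`, `conjLocal_toLocalRing`, `conjLocal_algebraMap`
import Literature.NumberTheory.AdelicBaseChange.PadicTensorCompletionGaloisProofs    -- ★ `galAdicCompletionMap_algebraMap_adicCompletion`
import Literature.NumberTheory.AdelicBaseChange.CompletionBaseChange                 -- ★ (FLT port) `Algebra ∕ ContinuousSMul ∕ FiniteDimensional (v.adicCompletion F) (w.1.adicCompletion E)`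
import Literature.NumberTheory.GaloisRepresentations.LocalFieldFiniteExtension       -- ★ R1 frame: `IsNonarchimedeanLocalField.nontriviallyNormedField`, `completeSpace_nontriviallyNormedField`
import Mathlib.Topology.Algebra.Module.FiniteDimension
import HarnessLib

/-!
# Quadratic place descent pins: at a non-split place `w ∣ v` of a quadratic extension `E ∕ F`, the structure map `ι_w : F_v → E_w` is a closed embedding whose
# image is the fixed field of `σ_w`; a skew unit; infinitely many norm-one elements

Topic `NumberTheory/Automorphic`; namespace `Literature.NumberTheory.Automorphic.UnitaryGroup` (the namespace of ★ `PlacesOver`, `toPlace`, `conjLocal`).  THEOREMS ONLY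
(no definition, no instance, no notation, no named fact, no `sorry`).  Cell `pub/hodgecm-mathlib`, crux H413 = `stmt-HodgeConjecture-24833` (lane `--supports`,
count-neutral); ROAD «HC-D» (holder F0P2-p01 (g23)), brick **(MP) «MODEL PINS FOR (MI)»** (consumer: LH6-p03's model instantiation `hcd_model` at `K := L_w`,
`F′ := L⁺_v`, `σ := σ_w = galAdicCompletionMap complexConj hw`).  HONEST LABEL: HC_CM is proved only modulo the 7 printed citations (2 remaining named inputs:
hLiu418 = `stmt-HodgeConjecture-24832`, h413 = `stmt-HodgeConjecture-24833`) until rung 0 closes; this file is unconditional and count-neutral.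

FRAME.  `E ∕ F` a quadratic extension of number fields, `c : E ≃ₐ[F] E` with `c ≠ 1`, `v` a finite place of `F`, `w : PlacesOver E v` NON-SPLIT (`c • w = w`);
`ι := algebraMap (v.adicCompletion F) (w.1.adicCompletion E)` (the FLT structure map `adicCompletionSemialgHom` = the tree's `toPlace v w`, definitionally),
`σ_w := galAdicCompletionMap c hw : E_w →+* E_w`.  The CM instance is `F := L⁺ = maximalRealSubfield L`, `E := L`, `c := complexConj` (zero adapters).

* §1 (m4-glob) `exists_apply_eq_neg_ne_zero` — a skew element `δ ∈ E`, `c δ = −δ ≠ 0` (public version of two private copies in the tree).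
* §2 (m2) `continuous_algebraMap_adicCompletion_place`, `toPlace_eq_algebraMap_adicCompletion` (`rfl`); §3′ **`isClosedEmbedding_algebraMap_adicCompletion_place`** at a non-split
  place (continuous left inverse = the first quadratic coordinate of ★ `quadraticLocalEquiv` read through `E ⊗_F F_v = E_w`; Mathlib `Function.LeftInverse.isClosedEmbedding`;
  no norm).
* §3 (m3) **`galAdicCompletionMap_eq_self_iff_mem_range`** — the fixed points of `σ_w` are exactly `ι(F_v)`: «⇐» is ★ `galAdicCompletionMap_algebraMap_adicCompletion`; «⇒» by the
  tree's quadratic coordinates on `E ⊗_F F_v = E_w` (`RingEquiv.piUnique` at a non-split place): `y = ι_v a + ι_v b·δ` uniquely (★ `existsUnique_eq_add_mul`),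
  `(c ⊗ 1) y = ι_v a − ι_v b·δ`, so a fixed `y` has `b = −b`, i.e. `b = 0` in characteristic `0`.
* §4 (m4) `exists_units_galAdicCompletionMap_eq_neg` — a skew UNIT `lam ∈ E_wˣ`, `σ_w lam = −lam` (`lam := δ`).
* §5 (hE) **`setOf_galAdicCompletionMap_mul_self_eq_one_infinite`** — the norm-one elements `{z | σ_w z · z = 1}` form an infinite set: `t ↦ (ι t + lam)(ι t − lam)⁻¹` is an
  injection of the infinite field `F_v` into it (`σ_w` swaps the two factors; `(ι t + lam)(ι s − lam) = (ι s + lam)(ι t − lam)` forces `2·lam·ι(s − t) = 0`).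
* §6 (m5) `two_ne_zero_adicCompletion`, `three_ne_zero_adicCompletion` (characteristic `0`).

## References
* [CasselsFrohlichANT1967] J. W. S. Cassels, A. Fröhlich (eds.), *Algebraic Number Theory* (1967), Ch. II §10 (completions of an extension, `E ⊗_F F_v = ∏ E_w`),
  Ch. VII §1.1 (the decomposition group acts on `E_w`; fixed field).
* [PlatonovRapinchuk1994] V. Platonov, A. Rapinchuk, *Algebraic Groups and Number Theory* (1994), §5.1 (local structure at a non-split place).
* [Serre1979] J.-P. Serre, *Local Fields*, GTM 67 (1979), Ch. II §3 (finite extensions of complete fields are complete; closed subfields).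
-/

set_option autoImplicit false

noncomputable section

open NumberField IsDedekindDomain Topology
open Literature.NumberTheory.AdelicBaseChange

namespace Literature.NumberTheory.Automorphic.UnitaryGroup

variable {F E : Type} [Field F] [NumberField F] [Field E] [NumberField E] [Algebra F E]

/-! ## §1 A skew element of the quadratic extension -/

/-- **In a quadratic extension `E∕F` with `c ≠ 1` there is `δ` with `c δ = −δ ≠ 0`** (`δ = e − c e` for any `e` moved by `c`; `c² = 1`).  Public version of the private
copies in ★ `LocalHermitianFormsRankThree` ∕ ★ `LocalHermitianPlaneIsotropic`. [cite: CasselsFrohlichANT1967, Ch. VII §1.1] -/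
theorem exists_apply_eq_neg_ne_zero [Algebra.IsQuadraticExtension F E] (c : E ≃ₐ[F] E) (hc : c ≠ 1) : ∃ δ : E, c δ = -δ ∧ δ ≠ 0 := by
  haveI : FiniteDimensional F E := Module.finite_of_finrank_eq_succ (Algebra.IsQuadraticExtension.finrank_eq_two F E)
  haveI : PerfectField F := inferInstance
  haveI : Algebra.IsAlgebraic F E := inferInstance
  haveI : Algebra.IsSeparable F E := inferInstance
  obtain ⟨e, he⟩ : ∃ e : E, c e ≠ e := by
    by_contra h
    push Not at h
    exact hc (AlgEquiv.ext h)
  refine ⟨e - c e, ?_, sub_ne_zero.mpr (Ne.symm he)⟩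
  have hcc : c (c e) = e := by
    have h := congrArg (fun f : E ≃ₐ[F] E => f e) (algEquiv_mul_self_eq_one F hc)
    simpa only [AlgEquiv.mul_apply, AlgEquiv.one_apply] using h
  rw [map_sub, hcc, neg_sub]

/-! ## §2 The structure map `ι_w : F_v → E_w` is a closed embedding -/

section Place

variable (v : HeightOneSpectrum (𝓞 F)) (w : PlacesOver E v)

/-- `ι_w = algebraMap F_v E_w` is continuous (the FLT `ContinuousSMul` instance; it is the tree's `toPlace v w` definitionally). [cite: CasselsFrohlichANT1967, Ch. II §10] -/
theorem continuous_algebraMap_adicCompletion_place : Continuous (algebraMap (v.adicCompletion F) (w.1.adicCompletion E)) :=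
  continuous_algebraMap _ _

/-- The tree's `toPlace v w` IS `algebraMap F_v E_w` (both are the completion of `F → E`; definitional). [cite: CasselsFrohlichANT1967, Ch. II §10] -/
theorem toPlace_eq_algebraMap_adicCompletion : toPlace v w = algebraMap (v.adicCompletion F) (w.1.adicCompletion E) := rfl

end Place

/-! ## §3 The fixed points of `σ_w` are `ι_w(F_v)` -/

section Fixed

variable [Algebra.IsQuadraticExtension F E] (c : E ≃ₐ[F] E) (hc : c ≠ 1)
  (v : HeightOneSpectrum (𝓞 F)) (w : PlacesOver E v) (hw : c • w.1 = w.1)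

include hc in
/-- **GALOIS DESCENT AT A NON-SPLIT COMPLETION: `σ_w x = x ↔ x ∈ ι_w(F_v)`.**  «⇐»: ★ `galAdicCompletionMap_algebraMap_adicCompletion`.  «⇒»: read `x` in
`E ⊗_F F_v = E_w` (one place above `v`), write it uniquely as `ι_v a + ι_v b · δ` with `c δ = −δ` (★ `existsUnique_eq_add_mul`); `c ⊗ 1` sends it to `ι_v a − ι_v b · δ`,
so `b = −b`, `b = 0`, `x = ι_w a`. [cite: CasselsFrohlichANT1967, Ch. VII §1.1] [cite: PlatonovRapinchuk1994, §5.1] -/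
theorem galAdicCompletionMap_eq_self_iff_mem_range (x : w.1.adicCompletion E) :
    galAdicCompletionMap (L := E) c hw x = x ↔ x ∈ Set.range (algebraMap (v.adicCompletion F) (w.1.adicCompletion E)) := by
  constructor
  · intro hx
    classical
    haveI : Subsingleton (PlacesOver E v) := PlacesOver.subsingleton_of_smul_eq c hc w hw
    letI : Unique (PlacesOver E v) := uniqueOfSubsingleton w
    obtain ⟨δ, hcδ, hδ⟩ := exists_apply_eq_neg_ne_zero c hc
    -- `x` read in `E ⊗_F F_v = E_w` (one place above `v`)
    let π : LocalRing E v ≃+* w.1.adicCompletion E := RingEquiv.piUnique fun w' : PlacesOver E v => w'.1.adicCompletion E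
    have hπ : ∀ z : LocalRing E v, π z = z w := fun _ => rfl
    let y : LocalRing E v := π.symm x
    have hyw : y w = x := by
      have h := π.apply_symm_apply x
      rwa [hπ] at h
    have hyfix : conjLocal E c v y = y := by
      rw [LocalRing.eq_iff_apply_eq c hc w hw]
      rw [conjLocal_apply_eq_of_smul_eq c hc v w hw y, hyw, hx]
    -- quadratic coordinates
    obtain ⟨p, hp, huniq⟩ := existsUnique_eq_add_mul E v c hcδ hδ y
    have hconj : conjLocal E c v y = toLocalRing E v p.1 + toLocalRing E v (-p.2) * algebraMap E (LocalRing E v) δ := by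
      conv_lhs => rw [hp]
      rw [map_add, map_mul, conjLocal_toLocalRing, conjLocal_toLocalRing, conjLocal_algebraMap, hcδ, map_neg, map_neg]
      ring
    rw [hyfix] at hconj
    have hp2 : (p.1, -p.2) = p := huniq (p.1, -p.2) hconj
    have hb : p.2 = 0 := by
      have h := congrArg Prod.snd hp2
      simp only at h
      -- `-b = b` in characteristic `0`
      have h2 : (2 : v.adicCompletion F) * p.2 = 0 := by linear_combination -h
      rcases mul_eq_zero.1 h2 with h0 | h0
      · exact absurd h0 two_ne_zero
      · exact h0
    refine ⟨p.1, ?_⟩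
    have hy : y = toLocalRing E v p.1 := by rw [hp, hb, map_zero, zero_mul, add_zero]
    have h := congrFun hy w
    rw [hyw, toLocalRing_apply] at h
    rw [← toPlace_eq_algebraMap_adicCompletion, h]
  · rintro ⟨a, rfl⟩
    exact galAdicCompletionMap_algebraMap_adicCompletion v c w w hw a

include hc hw in
/-- **`ι_w : F_v → E_w` is a CLOSED EMBEDDING at a non-split place** (continuous with a continuous left inverse: the first quadratic coordinate `a` of
`E_w = E ⊗_F F_v ∋ y = ι_v a + ι_v b · δ` (★ `quadraticLocalEquiv`), read through `E ⊗_F F_v = E_w` (one place above `v`); Mathlib `Function.LeftInverse.isClosedEmbedding`).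
No norm is used. [cite: Serre1979, Ch. II §3] [cite: CasselsFrohlichANT1967, Ch. II §10] -/
theorem isClosedEmbedding_algebraMap_adicCompletion_place : IsClosedEmbedding (algebraMap (v.adicCompletion F) (w.1.adicCompletion E)) := by
  classical
  haveI : T2Space (v.adicCompletion F) := (GaloisRepresentations.IsNonarchimedeanLocalField.isLocalField (v.adicCompletion F)).toT2Space
  haveI : Subsingleton (PlacesOver E v) := PlacesOver.subsingleton_of_smul_eq c hc w hw
  letI : Unique (PlacesOver E v) := uniqueOfSubsingleton w
  obtain ⟨δ, hcδ, hδ⟩ := exists_apply_eq_neg_ne_zero c hc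
  -- `E_w ≃ₜ E ⊗_F F_v` (one place) and the quadratic coordinates
  let πt : LocalRing E v ≃ₜ w.1.adicCompletion E := Homeomorph.piUnique fun w' : PlacesOver E v => w'.1.adicCompletion E
  have hπt : ∀ z : LocalRing E v, πt z = z w := fun _ => rfl
  let q := quadraticLocalEquiv E v c hcδ hδ
  -- the left inverse `r := fst ∘ q⁻¹ ∘ πt⁻¹`
  let r : w.1.adicCompletion E → v.adicCompletion F := fun x => (q.symm (πt.symm x)).1
  have hr : Continuous r := continuous_fst.comp (q.symm.continuous.comp πt.symm.continuous)
  have hleft : Function.LeftInverse r (algebraMap (v.adicCompletion F) (w.1.adicCompletion E)) := by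
    intro a
    have h1 : πt.symm (algebraMap (v.adicCompletion F) (w.1.adicCompletion E) a) = toLocalRing E v a := by
      apply πt.injective
      rw [Homeomorph.apply_symm_apply, hπt, toLocalRing_apply, toPlace_eq_algebraMap_adicCompletion]
    have h2 : q (a, 0) = toLocalRing E v a := by
      change quadraticLocalEquiv E v c hcδ hδ (a, 0) = _
      rw [quadraticLocalEquiv_apply, map_zero, zero_mul, add_zero]
    change (q.symm (πt.symm (algebraMap (v.adicCompletion F) (w.1.adicCompletion E) a))).1 = a
    rw [h1, ← h2, ContinuousLinearEquiv.symm_apply_apply]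
  exact hleft.isClosedEmbedding hr (continuous_algebraMap_adicCompletion_place v w)

/-! ## §4 A skew unit at the completion -/

include hc in
/-- **A SKEW UNIT `lam ∈ E_wˣ`, `σ_w lam = −lam`** (`lam := δ` of §1 read in `E_w`; ★ `galAdicCompletionMap_coe_algEquiv`). [cite: CasselsFrohlichANT1967, Ch. VII §1.1] -/
theorem exists_units_galAdicCompletionMap_eq_neg :
    ∃ lam : (w.1.adicCompletion E)ˣ, galAdicCompletionMap (L := E) c hw (lam : w.1.adicCompletion E) = -(lam : w.1.adicCompletion E) := by
  obtain ⟨δ, hcδ, hδ⟩ := exists_apply_eq_neg_ne_zero c hc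
  have hδw : ((δ : E) : w.1.adicCompletion E) ≠ 0 := by
    intro h
    exact hδ ((algebraMap E (w.1.adicCompletion E)).injective (by rw [map_zero]; exact h))
  refine ⟨Units.mk0 _ hδw, ?_⟩
  rw [Units.val_mk0, galAdicCompletionMap_coe_algEquiv (σ := c) (h := hw) (x := δ), hcδ]
  exact map_neg (algebraMap E (w.1.adicCompletion E)) δ

/-! ## §5 Infinitely many norm-one elements -/

include hc in
/-- **THE NORM-ONE ELEMENTS OF `E_w` FORM AN INFINITE SET**: `{z | σ_w z · z = 1}` contains the injective image `t ↦ (ι t + lam)(ι t − lam)⁻¹` of the infinite field `F_v`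
(`σ_w` exchanges the two factors; equal values force `2 · lam · ι(s − t) = 0`). [cite: PlatonovRapinchuk1994, §5.1] [cite: CasselsFrohlichANT1967, Ch. VII §1.1] -/
theorem setOf_galAdicCompletionMap_mul_self_eq_one_infinite :
    {z : w.1.adicCompletion E | galAdicCompletionMap (L := E) c hw z * z = 1}.Infinite := by
  obtain ⟨lam, hlam⟩ := exists_units_galAdicCompletionMap_eq_neg c hc v w hw
  set ι := algebraMap (v.adicCompletion F) (w.1.adicCompletion E) with hιdef
  set σ := galAdicCompletionMap (L := E) c hw with hσdef
  have hσι : ∀ t, σ (ι t) = ι t := fun t => galAdicCompletionMap_algebraMap_adicCompletion v c w w hw t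
  have hlam0 : (lam : w.1.adicCompletion E) ≠ 0 := lam.ne_zero
  have h2 : (2 : w.1.adicCompletion E) ≠ 0 := two_ne_zero
  -- `lam ∉ ι(F_v)`: a fixed point would give `lam = −lam`
  have hden : ∀ t, ι t - (lam : w.1.adicCompletion E) ≠ 0 := by
    intro t h
    have hl : (lam : w.1.adicCompletion E) = ι t := (sub_eq_zero.1 h).symm
    have : σ (lam : w.1.adicCompletion E) = lam := by rw [hl, hσι]
    rw [hlam] at this
    have h2l : (2 : w.1.adicCompletion E) * lam = 0 := by linear_combination -this
    rcases mul_eq_zero.1 h2l with h0 | h0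
    · exact h2 h0
    · exact hlam0 h0
  have hnum : ∀ t, ι t + (lam : w.1.adicCompletion E) ≠ 0 := by
    intro t h
    have hl : (lam : w.1.adicCompletion E) = ι (-t) := by rw [map_neg]; linear_combination h
    have : σ (lam : w.1.adicCompletion E) = lam := by rw [hl, hσι]
    rw [hlam] at this
    have h2l : (2 : w.1.adicCompletion E) * lam = 0 := by linear_combination -this
    rcases mul_eq_zero.1 h2l with h0 | h0
    · exact h2 h0
    · exact hlam0 h0
  -- the injection
  let f : v.adicCompletion F → w.1.adicCompletion E := fun t => (ι t + lam) * (ι t - lam)⁻¹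
  have hmem : ∀ t, f t ∈ {z : w.1.adicCompletion E | σ z * z = 1} := by
    intro t
    simp only [Set.mem_setOf_eq, f, map_mul, map_inv₀, map_add, map_sub, hσι, hlam]
    have h1 := hden t
    have h3 : ι t - -(lam : w.1.adicCompletion E) ≠ 0 := by rw [sub_neg_eq_add]; exact hnum t
    field_simp
    ring
  have hinj : Function.Injective f := by
    intro s t hst
    simp only [f] at hst
    have hs := hden s; have ht := hden t
    have key : (ι s + lam) * (ι t - lam) = (ι t + lam) * (ι s - lam) := by
      field_simp at hst
      linear_combination hst
    have h2l : (2 : w.1.adicCompletion E) * lam * (ι t - ι s) = 0 := by linear_combination key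
    rcases mul_eq_zero.1 h2l with h0 | h0
    · rcases mul_eq_zero.1 h0 with h00 | h00
      · exact absurd h00 h2
      · exact absurd h00 hlam0
    · exact ((algebraMap (v.adicCompletion F) (w.1.adicCompletion E)).injective (sub_eq_zero.1 h0)).symm
  exact Set.infinite_of_injective_forall_mem hinj hmem

end Fixed

/-! ## §6 Characteristic zero -/

section Char

variable (w : HeightOneSpectrum (𝓞 E))

/-- `2 ≠ 0` in `E_w` (characteristic `0`). [cite: CasselsFrohlichANT1967, Ch. II §10] -/
theorem two_ne_zero_adicCompletion : (2 : w.adicCompletion E) ≠ 0 := two_ne_zero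

/-- `3 ≠ 0` in `E_w` (characteristic `0`). [cite: CasselsFrohlichANT1967, Ch. II §10] -/
theorem three_ne_zero_adicCompletion : (3 : w.adicCompletion E) ≠ 0 := three_ne_zero

end Char

end Literature.NumberTheory.Automorphic.UnitaryGroup

end
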